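/-
Copyright: the b2b-balaban T⁴-continuum CRUX team, row NE7b OWNER lineage `t4-ne7b-p1` (gen 139). Project licence.
-/
import Mathlib.Analysis.SpecificLimits.Basic
import Mathlib.Data.Matrix.Mul
import Mathlib.Topology.Algebra.InfiniteSum.Ring

/-!
# DOBRUSHIN'S MATRIX `D = Σ_n C^n` — the Neumann series of a nonnegative matrix with row sums `≤ γ < 1` (SCOPING (d10)(2)): for
# `C : Matrix ι ι ℝ` with `C ≥ 0` and `Σ_zC_{xz} ≤ γ < 1`, the entrywise series `D_{xy} = Σ_{n≥0} (C^n)_{xy}` converges, is nonnegative,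
# satisfies the EXACT resolvent identity `D = I + D·C` (hence the input `I + D·C ≤ D` of (440)∕(442)∕(447)), and has the ROW letter
# `Σ_yD_{xy} ≤ 1∕(1−γ)`; if moreover the columns of `C` sum to `≤ γ′ < 1`, the COLUMN letter `Σ_xD_{xy} ≤ 1∕(1−γ′)` — the two letters that
# make (447)'s covariance estimate a VOLUME-UNIFORM kernel letter (row NE7b, node U5c; Mathlib only; [folklore])

Cell `pub-balaban`, sub-cell `t4`, spine estimate NE7b (`T4WeightBudget.RelWeightBound`; the cell's OWN estimate — NOT PRINTED in
[Bałaban 1983–89], NOT PROVED).  Crux-route work under `Spine/NE7b/` by the row OWNER (`t4-ne7b-p1` gen 139, file (448)) under FREEZE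
(0)'s crux-prover clause; NOTHING of Bałaban's is named as a Lean object, valued or asserted; no `T4Continuum/Support` leaf typed; no
`def`, no notation (`D` is WRITTEN OUT as `fun x y => ∑' n, (C ^ n) x y`); zero `sorry`.  Imports: Mathlib only (fast lane).

WHAT IS PROVED ([folklore]; `C : Matrix ι ι ℝ`, `hC : 0 ≤ C_{xz}`, `hrow : Σ_zC_{xz} ≤ γ`, `0 ≤ γ < 1`; `hcol : Σ_xC_{xy} ≤ γ′` for §3):
* §1 powers: `pow_entry_nonneg`, `pow_rowsum_le` (`Σ_y(C^n)_{xy} ≤ γ^n`), `pow_entry_le` (`(C^n)_{xy} ≤ γ^n`), `pow_colsum_le` (`Σ_x(C^n)_{xy} ≤ γ′^n`),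
  `summable_pow_entry`.
* §2 the series: `neumann_nonneg` (`0 ≤ D_{xy}`), **`neumann_resolvent`** (`D_{xy} = δ_{xy} + Σ_z D_{xz}C_{zy}`), `neumann_dominates`
  (`δ_{xy} + Σ_zD_{xz}C_{zy} ≤ D_{xy}`, the input of (440)), **`neumann_rowsum_le`** (`Σ_yD_{xy} ≤ (1−γ)⁻¹`).
* §3 **`neumann_colsum_le`** (`Σ_xD_{xy} ≤ (1−γ′)⁻¹`).
* §4 toy (kernel): `C = 0` gives `D = I` at the entry `(x,x)`: `Σ_n (0^n)_{xx} = 1`.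

HONEST (what this is NOT).  Bookkeeping of a convergent matrix series; no decay RATE (an exponentially weighted version — conjugating `C`
by `e^{μd(x,·)}` — is the same computation with `γ` replaced by the weighted row letter, not typed here).  Scalar skeleton ((A3), NC-NE7b-α
UNRULED); nothing of Bałaban's asserted.  BY-NAME EFFECT ON THE WALL: NONE.  NE7b NOT PRINTED ∕ NOT PROVED; spine PROVED 0∕9; rung (B)+1 —
the programme's measures remain FINITE-torus statements; NOT the mass gap, NOT Clay.  HONEST DEPENDENCY: continuum YM on T⁴ ⇐ BetaPertH ∧
nine spine estimates (0∕9 proved); BetaPertH ⇐ (D1) ∧ (D4) ∧ CAP+tail; G-an2-4 gates asym, D1 and NE2∕3∕4.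
-/

set_option autoImplicit false

noncomputable section

namespace Summit.QuantumFields.BalabanUV.T4Continuum.NE7b.SupDobrushinNeumannMatrix

open Finset
open scoped BigOperators

variable {ι : Type} [Fintype ι] [DecidableEq ι]

variable {C : Matrix ι ι ℝ} {γ γ' : ℝ}

/-! ## §1. The powers of `C` -/

/-- The entries of `C^n` are nonnegative. [folklore] -/
theorem pow_entry_nonneg (hC : ∀ x z, 0 ≤ C x z) : ∀ (n : ℕ) (x y : ι), 0 ≤ (C ^ n) x y := by
  intro n
  induction n with
  | zero => intro x y; rw [pow_zero, Matrix.one_apply]; split_ifs <;> norm_num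
  | succ n ih => intro x y; rw [pow_succ, Matrix.mul_apply]; exact Finset.sum_nonneg fun z _ => mul_nonneg (ih x z) (hC z y)

/-- **Row sums of the powers**: `Σ_y (C^n)_{xy} ≤ γ^n`. [folklore] -/
theorem pow_rowsum_le (hC : ∀ x z, 0 ≤ C x z) (hrow : ∀ x, ∑ z, C x z ≤ γ) : ∀ (n : ℕ) (x : ι), ∑ y, (C ^ n) x y ≤ γ ^ n := by
  intro n
  induction n with
  | zero => intro x; rw [pow_zero, pow_zero]; simp [Matrix.one_apply]
  | succ n ih =>
    intro x
    have hγ : 0 ≤ γ := (Finset.sum_nonneg fun z _ => hC x z).trans (hrow x)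
    calc ∑ y, (C ^ (n + 1)) x y = ∑ y, ∑ z, (C ^ n) x z * C z y := Finset.sum_congr rfl fun y _ => by rw [pow_succ, Matrix.mul_apply]
      _ = ∑ z, (C ^ n) x z * ∑ y, C z y := by rw [Finset.sum_comm]; exact Finset.sum_congr rfl fun z _ => by rw [Finset.mul_sum]
      _ ≤ ∑ z, (C ^ n) x z * γ := Finset.sum_le_sum fun z _ => mul_le_mul_of_nonneg_left (hrow z) (pow_entry_nonneg hC n x z)
      _ ≤ γ ^ n * γ := by rw [← Finset.sum_mul]; exact mul_le_mul_of_nonneg_right (ih x) hγ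
      _ = γ ^ (n + 1) := by rw [pow_succ]

/-- An entry is at most the row sum: `(C^n)_{xy} ≤ γ^n`. [folklore] -/
theorem pow_entry_le (hC : ∀ x z, 0 ≤ C x z) (hrow : ∀ x, ∑ z, C x z ≤ γ) (n : ℕ) (x y : ι) : (C ^ n) x y ≤ γ ^ n :=
  (Finset.single_le_sum (f := fun y => (C ^ n) x y) (fun z _ => pow_entry_nonneg hC n x z) (Finset.mem_univ y)).trans
    (pow_rowsum_le hC hrow n x)

/-- **Column sums of the powers**: `Σ_x (C^n)_{xy} ≤ γ′^n`. [folklore] -/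
theorem pow_colsum_le (hC : ∀ x z, 0 ≤ C x z) (hcol : ∀ y, ∑ x, C x y ≤ γ') : ∀ (n : ℕ) (y : ι), ∑ x, (C ^ n) x y ≤ γ' ^ n := by
  intro n
  induction n with
  | zero => intro y; rw [pow_zero, pow_zero]; simp [Matrix.one_apply]
  | succ n ih =>
    intro y
    have hγ : 0 ≤ γ' := (Finset.sum_nonneg fun x _ => hC x y).trans (hcol y)
    calc ∑ x, (C ^ (n + 1)) x y = ∑ x, ∑ z, (C ^ n) x z * C z y := Finset.sum_congr rfl fun x _ => by rw [pow_succ, Matrix.mul_apply]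
      _ = ∑ z, (∑ x, (C ^ n) x z) * C z y := by rw [Finset.sum_comm]; exact Finset.sum_congr rfl fun z _ => by rw [Finset.sum_mul]
      _ ≤ ∑ z, γ' ^ n * C z y := Finset.sum_le_sum fun z _ => mul_le_mul_of_nonneg_right (ih z) (hC z y)
      _ ≤ γ' ^ n * γ' := by rw [← Finset.mul_sum]; exact mul_le_mul_of_nonneg_left (hcol y) (pow_nonneg hγ n)
      _ = γ' ^ (n + 1) := by rw [pow_succ]

/-- **The entrywise series converges** (geometric domination). [folklore] -/
theorem summable_pow_entry (hC : ∀ x z, 0 ≤ C x z) (hrow : ∀ x, ∑ z, C x z ≤ γ) (hγ0 : 0 ≤ γ) (hγ1 : γ < 1) (x y : ι) :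
    Summable fun n : ℕ => (C ^ n) x y :=
  Summable.of_nonneg_of_le (fun n => pow_entry_nonneg hC n x y) (fun n => pow_entry_le hC hrow n x y)
    (summable_geometric_of_lt_one hγ0 hγ1)

/-! ## §2. The Neumann series `D_{xy} = Σ_n (C^n)_{xy}` -/

/-- `D ≥ 0`. [folklore] -/
theorem neumann_nonneg (hC : ∀ x z, 0 ≤ C x z) (x y : ι) : 0 ≤ ∑' n : ℕ, (C ^ n) x y :=
  tsum_nonneg fun n => pow_entry_nonneg hC n x y

/-- **THE RESOLVENT IDENTITY `D = I + D·C`**, entrywise: `Σ_n(C^n)_{xy} = δ_{xy} + Σ_z (Σ_n(C^n)_{xz})·C_{zy}`. [folklore] -/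
theorem neumann_resolvent (hC : ∀ x z, 0 ≤ C x z) (hrow : ∀ x, ∑ z, C x z ≤ γ) (hγ0 : 0 ≤ γ) (hγ1 : γ < 1) (x y : ι) :
    ∑' n : ℕ, (C ^ n) x y = (if x = y then (1 : ℝ) else 0) + ∑ z, (∑' n : ℕ, (C ^ n) x z) * C z y := by
  have hs := summable_pow_entry hC hrow hγ0 hγ1
  rw [(hs x y).tsum_eq_zero_add, pow_zero, Matrix.one_apply]
  congr 1
  -- `Σ_n (C^{n+1})_{xy} = Σ_n Σ_z (C^n)_{xz}C_{zy} = Σ_z (Σ_n (C^n)_{xz}) C_{zy}`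
  have e : ∀ n : ℕ, (C ^ (n + 1)) x y = ∑ z, (C ^ n) x z * C z y := fun n => by rw [pow_succ, Matrix.mul_apply]
  simp_rw [e]
  rw [Summable.tsum_finsetSum fun z _ => (hs x z).mul_right (C z y)]
  exact Finset.sum_congr rfl fun z _ => tsum_mul_right

/-- **`I + D·C ≤ D`** (with equality) — the input `hDC` of (440), (442), (447). [folklore] -/
theorem neumann_dominates (hC : ∀ x z, 0 ≤ C x z) (hrow : ∀ x, ∑ z, C x z ≤ γ) (hγ0 : 0 ≤ γ) (hγ1 : γ < 1) (x y : ι) :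
    (if x = y then (1 : ℝ) else 0) + ∑ z, (∑' n : ℕ, (C ^ n) x z) * C z y ≤ ∑' n : ℕ, (C ^ n) x y :=
  (neumann_resolvent hC hrow hγ0 hγ1 x y).symm.le

/-- **THE ROW LETTER `Σ_y D_{xy} ≤ (1−γ)⁻¹`**. [folklore] -/
theorem neumann_rowsum_le (hC : ∀ x z, 0 ≤ C x z) (hrow : ∀ x, ∑ z, C x z ≤ γ) (hγ0 : 0 ≤ γ) (hγ1 : γ < 1) (x : ι) :
    ∑ y, ∑' n : ℕ, (C ^ n) x y ≤ (1 - γ)⁻¹ := by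
  have hs := summable_pow_entry hC hrow hγ0 hγ1
  rw [← Summable.tsum_finsetSum fun y _ => hs x y, ← tsum_geometric_of_lt_one hγ0 hγ1]
  exact Summable.tsum_le_tsum (fun n => pow_rowsum_le hC hrow n x) (summable_sum fun y _ => hs x y)
    (summable_geometric_of_lt_one hγ0 hγ1)

/-! ## §3. The column letter -/

/-- **THE COLUMN LETTER `Σ_x D_{xy} ≤ (1−γ′)⁻¹`** (columns of `C` summing to `≤ γ′ < 1`; rows to `≤ γ < 1` for convergence). [folklore] -/
theorem neumann_colsum_le (hC : ∀ x z, 0 ≤ C x z) (hrow : ∀ x, ∑ z, C x z ≤ γ) (hγ0 : 0 ≤ γ) (hγ1 : γ < 1)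
    (hcol : ∀ y, ∑ x, C x y ≤ γ') (hγ'1 : γ' < 1) (y : ι) : ∑ x, ∑' n : ℕ, (C ^ n) x y ≤ (1 - γ')⁻¹ := by
  have hs := summable_pow_entry hC hrow hγ0 hγ1
  rcases isEmpty_or_nonempty ι with hι | ⟨⟨x₀⟩⟩
  · exact (hι.false y).elim
  have hγ'0 : 0 ≤ γ' := (Finset.sum_nonneg fun x _ => hC x y).trans (hcol y)
  rw [← Summable.tsum_finsetSum fun x _ => hs x y, ← tsum_geometric_of_lt_one hγ'0 hγ'1]
  exact Summable.tsum_le_tsum (fun n => pow_colsum_le hC hcol n y) (summable_sum fun x _ => hs x y)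
    (summable_geometric_of_lt_one hγ'0 hγ'1)

/-! ## §4. Toy instance (kernel) -/

/-- Toy: for `C = 0` on `Fin 1` the Neumann series at the diagonal entry is `Σ_n (0^n)_{00} = 1` (`D = I`). -/
example : ∑' n : ℕ, ((0 : Matrix (Fin 1) (Fin 1) ℝ) ^ n) 0 0 = 1 := by
  have e : ∀ n : ℕ, ((0 : Matrix (Fin 1) (Fin 1) ℝ) ^ n) 0 0 = if n = 0 then (1 : ℝ) else 0 := by
    intro n
    cases n with
    | zero => simp
    | succ n => rw [pow_succ, Matrix.mul_zero]; simp
  simp_rw [e]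
  rw [tsum_ite_eq]

end Summit.QuantumFields.BalabanUV.T4Continuum.NE7b.SupDobrushinNeumannMatrix

end
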